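import Summits.Parity.GeneralizedHardyLittlewood.Theorems.LiouvilleShiftedTablesPairsToGHLStubRungAtomsAux1

/-!
# Sloped ladder, rung — atoms piece, part 2: opening the atoms sum

Route `LiouvilleShiftedTables` (Parity / GeneralizedHardyLittlewood), crux stmt-Parity-9389 (`PairsToGHL`),
line `sloped_ladder`, stub `stub_rungAtomsPart` (lead).  With `m(n) = a n + b` (`a ≥ 1`), a weight
`F : ℕ → ℝ` and a cut-off `M₀`, the atoms piece of the rung is

  `A(N) = Σ_{n ≤ N} F(n) Σ_{(d,e) : de = m(n), e ≤ M₀} μ(d) log e`.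

This file rewrites it (pure algebra):

* `inner_atoms_eq` — `Σ_{(d,e), e ≤ M₀} μ(d) log e = Σ_{e ≤ M₀, e ∣ m} μ(m/e) log e`;
* `atoms_sum_swap` — `A(N) = Σ_{e ≤ M₀} log e · T_e(N)`, `T_e(N) = Σ_{n ≤ N, e ∣ m(n)} μ(m(n)/e) F(n)`;
* `T_eq_liouville_sum` — `T_e(N) = λ(e) Σ_{j ≤ J} μ(j) U_{e j²}(N)`, `U_q(N) = Σ_{n ≤ N, q ∣ m(n)} λ(m(n)) F(n)`
  (squarefree switch, `J ≥ (a+b) N`);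
* `abs_T_le`, `abs_U_le` — `|T_e(N)| ≤ Σ_j |U_{ej²}(N)|`, `|U_q(N)| ≤ F_max · (a+b)N/q`;
* `exists_class_sum` — `U_q(N)` is the one-class sum `Σ_{n ≤ N, n ≡ ρ_q (q/gcd(a,q))} λ(m(n))F(n)` if
  `gcd(a,q) ∣ b`, and `0` otherwise.

[folklore]
-/

open Finset

namespace Summit.Parity.GeneralizedHardyLittlewood.Theorems.PairsToGHL.SlopedLadder

namespace RungAtoms

open scoped ArithmeticFunction.Moebius

/-! ### The inner sum over the antidiagonal -/

/-- For `m ≠ 0`: the part `e ≤ M₀` of `Σ_{(d,e): de = m} μ(d) log e` is `Σ_{e ≤ M₀, e ∣ m} μ(m/e) log e`.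
[folklore] -/
theorem inner_atoms_eq {m : ℕ} (hm : m ≠ 0) (M₀ : ℕ) :
    ∑ x ∈ (Nat.divisorsAntidiagonal m).filter (fun x : ℕ × ℕ => x.2 ≤ M₀),
        ((μ x.1 : ℤ) : ℝ) * Real.log x.2 =
      ∑ e ∈ (Icc 1 M₀).filter (fun e : ℕ => e ∣ m), ((μ (m / e) : ℤ) : ℝ) * Real.log e := by
  rw [Finset.sum_filter, Nat.sum_divisorsAntidiagonal' (f := fun d e =>
    if e ≤ M₀ then ((μ d : ℤ) : ℝ) * Real.log e else 0), Finset.sum_filter]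
  -- both sides are sums over `e ∣ m`; match the index sets
  have hset : ∀ e : ℕ, (e ∈ m.divisors ∧ e ≤ M₀) ↔ (e ∈ Icc 1 M₀ ∧ e ∣ m) := by
    intro e
    rw [Nat.mem_divisors, Finset.mem_Icc]
    constructor
    · rintro ⟨⟨hd, -⟩, hle⟩
      exact ⟨⟨Nat.pos_of_dvd_of_pos hd (Nat.pos_of_ne_zero hm), hle⟩, hd⟩
    · rintro ⟨⟨-, hle⟩, hd⟩
      exact ⟨⟨hd, hm⟩, hle⟩
  rw [← Finset.sum_filter, ← Finset.sum_filter]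
  refine Finset.sum_congr ?_ fun _ _ => rfl
  ext e
  simp only [Finset.mem_filter]
  exact hset e

/-! ### Swapping the `n`- and `e`-sums -/

variable (a b : ℕ) (F : ℕ → ℝ)

/-- `A(N) = Σ_{e ≤ M₀} log e · T_e(N)`. [folklore] -/
theorem atoms_sum_swap (N M₀ : ℕ) :
    ∑ n ∈ Icc 1 N, F n * ∑ e ∈ (Icc 1 M₀).filter (fun e : ℕ => e ∣ a * n + b),
        ((μ ((a * n + b) / e) : ℤ) : ℝ) * Real.log e =
      ∑ e ∈ Icc 1 M₀, Real.log e *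
        ∑ n ∈ (Icc 1 N).filter (fun n : ℕ => e ∣ a * n + b),
          ((μ ((a * n + b) / e) : ℤ) : ℝ) * F n := by
  simp_rw [Finset.sum_filter, Finset.mul_sum]
  rw [Finset.sum_comm]
  refine Finset.sum_congr rfl fun e _ => Finset.sum_congr rfl fun n _ => ?_
  split_ifs <;> ring

/-! ### The squarefree switch inside `T_e(N)` -/

/-- **`T_e(N) = λ(e) Σ_{j ≤ J} μ(j) U_{e j²}(N)`** for `a ≥ 1`, `e ≥ 1` and `J ≥ (a + b) N`. [folklore] -/
theorem T_eq_liouville_sum {a : ℕ} (ha : 0 < a) (b : ℕ) (F : ℕ → ℝ) {e : ℕ} (he : e ≠ 0)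
    {N J : ℕ} (hJ : (a + b) * N ≤ J) :
    ∑ n ∈ (Icc 1 N).filter (fun n : ℕ => e ∣ a * n + b), ((μ ((a * n + b) / e) : ℤ) : ℝ) * F n =
      ((ArithmeticFunction.liouville e : ℤ) : ℝ) *
        ∑ j ∈ Icc 1 J, ((μ j : ℤ) : ℝ) *
          ∑ n ∈ (Icc 1 N).filter (fun n : ℕ => e * j ^ 2 ∣ a * n + b),
            ((ArithmeticFunction.liouville (a * n + b) : ℤ) : ℝ) * F n := by
  -- pointwise switch
  have hpt : ∀ n ∈ (Icc 1 N).filter (fun n : ℕ => e ∣ a * n + b),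
      ((μ ((a * n + b) / e) : ℤ) : ℝ) * F n =
        ((ArithmeticFunction.liouville e : ℤ) : ℝ) *
          ∑ j ∈ Icc 1 J, ((μ j : ℤ) : ℝ) *
            (if e * j ^ 2 ∣ a * n + b then
              ((ArithmeticFunction.liouville (a * n + b) : ℤ) : ℝ) * F n else 0) := by
    intro n hn
    rw [Finset.mem_filter, Finset.mem_Icc] at hn
    obtain ⟨⟨hn1, hnN⟩, hen⟩ := hn
    have hk : a * n + b ≠ 0 := by
      have : 1 ≤ a * n := Nat.one_le_iff_ne_zero.mpr (Nat.mul_ne_zero ha.ne' (by omega))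
      omega
    have hkJ : a * n + b ≤ J := by
      refine le_trans ?_ hJ
      have h1 : a * n ≤ a * N := Nat.mul_le_mul_left a hnN
      have h2 : b ≤ b * N := Nat.le_mul_of_pos_right b (by omega)
      calc a * n + b ≤ a * N + b * N := Nat.add_le_add h1 h2
        _ = (a + b) * N := by ring
    rw [moebius_div_eq_liouville_mul_sum hk he hen hkJ, Finset.sum_filter]
    simp only [Finset.mul_sum, Finset.sum_mul]
    refine Finset.sum_congr rfl fun j _ => ?_
    split_ifs <;> ring
  rw [Finset.sum_congr rfl hpt, ← Finset.mul_sum, Finset.sum_comm]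
  congr 1
  refine Finset.sum_congr rfl fun j _ => ?_
  rw [Finset.mul_sum, Finset.sum_filter, Finset.sum_filter]
  refine Finset.sum_congr rfl fun n _ => ?_
  by_cases h1 : e * j ^ 2 ∣ a * n + b
  · rw [if_pos h1, if_pos (Dvd.dvd.trans (Dvd.intro _ rfl) h1), if_pos h1]
  · rw [if_neg h1]
    split_ifs <;> simp

/-- `|T_e(N)| ≤ Σ_{j ≤ J} |U_{e j²}(N)|`. [folklore] -/
theorem abs_T_le {a : ℕ} (ha : 0 < a) (b : ℕ) (F : ℕ → ℝ) {e : ℕ} (he : e ≠ 0)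
    {N J : ℕ} (hJ : (a + b) * N ≤ J) :
    |∑ n ∈ (Icc 1 N).filter (fun n : ℕ => e ∣ a * n + b), ((μ ((a * n + b) / e) : ℤ) : ℝ) * F n| ≤
      ∑ j ∈ Icc 1 J, |∑ n ∈ (Icc 1 N).filter (fun n : ℕ => e * j ^ 2 ∣ a * n + b),
            ((ArithmeticFunction.liouville (a * n + b) : ℤ) : ℝ) * F n| := by
  rw [T_eq_liouville_sum ha b F he hJ, abs_mul, abs_liouville_real_eq_one he, one_mul]
  refine (Finset.abs_sum_le_sum_abs _ _).trans (Finset.sum_le_sum fun j _ => ?_)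
  rw [abs_mul]
  exact mul_le_of_le_one_left (abs_nonneg _) (abs_moebius_real_le_one j)

/-- **Trivial bound** `|U_q(N)| ≤ F_max · ((a+b)N / q)` for `0 ≤ F ≤ F_max` on `[1, N]`. [folklore] -/
theorem abs_U_le {a : ℕ} (ha : 0 < a) (b : ℕ) {F : ℕ → ℝ} {Fb : ℝ} {N : ℕ} (hF0 : ∀ n, 0 ≤ F n)
    (hFb0 : 0 ≤ Fb) (hFb : ∀ n ∈ Icc 1 N, F n ≤ Fb) (q : ℕ) :
    |∑ n ∈ (Icc 1 N).filter (fun n : ℕ => q ∣ a * n + b),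
        ((ArithmeticFunction.liouville (a * n + b) : ℤ) : ℝ) * F n| ≤
      Fb * (((a + b) * N / q : ℕ) : ℝ) := by
  calc |∑ n ∈ (Icc 1 N).filter (fun n : ℕ => q ∣ a * n + b),
          ((ArithmeticFunction.liouville (a * n + b) : ℤ) : ℝ) * F n|
      ≤ ∑ n ∈ (Icc 1 N).filter (fun n : ℕ => q ∣ a * n + b),
          |((ArithmeticFunction.liouville (a * n + b) : ℤ) : ℝ) * F n| := Finset.abs_sum_le_sum_abs _ _
    _ ≤ ∑ n ∈ (Icc 1 N).filter (fun n : ℕ => q ∣ a * n + b), Fb := by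
        refine Finset.sum_le_sum fun n hn => ?_
        have hn' : n ∈ Icc 1 N := (Finset.mem_filter.mp hn).1
        have hk : a * n + b ≠ 0 := by
          have h1 : 1 ≤ n := (Finset.mem_Icc.mp hn').1
          have : 1 ≤ a * n := Nat.one_le_iff_ne_zero.mpr (Nat.mul_ne_zero ha.ne' (by omega))
          omega
        rw [abs_mul, abs_liouville_real_eq_one hk, one_mul, abs_of_nonneg (hF0 n)]
        exact hFb n hn'
    _ = #((Icc 1 N).filter (fun n : ℕ => q ∣ a * n + b)) * Fb := by rw [Finset.sum_const, nsmul_eq_mul]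
    _ ≤ (((a + b) * N / q : ℕ) : ℝ) * Fb := by
        gcongr
        exact_mod_cast card_filter_dvd_linear_le ha b q N
    _ = Fb * (((a + b) * N / q : ℕ) : ℝ) := mul_comm _ _

/-- **One class.** For `a, q ≥ 1` there is `ρ < q/gcd(a,q)` with, for every `N` and every `G : ℕ → ℝ`:
`Σ_{n ≤ N, q ∣ a n + b} G(n) = 𝟙[gcd(a,q) ∣ b] · Σ_{n ≤ N, n ≡ ρ (q/gcd(a,q))} G(n)`. [folklore] -/
theorem exists_class_sum {a q : ℕ} (ha : 0 < a) (hq : 0 < q) (b : ℕ) :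
    ∃ ρ : ℕ, ρ < q / Nat.gcd a q ∧ ∀ (N : ℕ) (G : ℕ → ℝ),
      ∑ n ∈ (Icc 1 N).filter (fun n : ℕ => q ∣ a * n + b), G n =
        if Nat.gcd a q ∣ b then
          ∑ n ∈ (Icc 1 N).filter (fun n : ℕ => n ≡ ρ [MOD (q / Nat.gcd a q)]), G n
        else 0 := by
  obtain ⟨ρ, hρ, hiff⟩ := exists_class ha hq b
  refine ⟨ρ, hρ, fun N G => ?_⟩
  split_ifs with hg
  · refine Finset.sum_congr ?_ fun _ _ => rfl
    ext n
    simp only [Finset.mem_filter, hiff n, hg, true_and]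
  · refine Finset.sum_eq_zero fun n hn => ?_
    exact (hg ((hiff n).mp (Finset.mem_filter.mp hn).2).1).elim

end RungAtoms

/-- **Registered sub-goal `stub_rungAtomsPart_part2`** (the squarefree switch inside `T_e(N)`, uncurried form of `RungAtoms.T_eq_liouville_sum`). [folklore] -/
theorem stub_rungAtomsPart_part2 : ∀ (a b : ℕ) (F : ℕ → ℝ) (e N J : ℕ), 0 < a → e ≠ 0 → (a + b) * N ≤ J → (∑ n ∈ (Finset.Icc 1 N).filter (fun n : ℕ => e ∣ a * n + b), ((ArithmeticFunction.moebius ((a * n + b) / e) : ℤ) : ℝ) * F n) = ((ArithmeticFunction.liouville e : ℤ) : ℝ) * ∑ j ∈ Finset.Icc 1 J, ((ArithmeticFunction.moebius j : ℤ) : ℝ) * ∑ n ∈ (Finset.Icc 1 N).filter (fun n : ℕ => e * j ^ 2 ∣ a * n + b), ((ArithmeticFunction.liouville (a * n + b) : ℤ) : ℝ) * F n :=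
  fun _ b F _ _ _ ha he hJ => RungAtoms.T_eq_liouville_sum ha b F he hJ

end Summit.Parity.GeneralizedHardyLittlewood.Theorems.PairsToGHL.SlopedLadder
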